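import Mathlib
import HarnessLib

/-!
# A certified sieve for the summatory Liouville function `L(x) = ∑_{n ≤ x} λ(n)`

Topic: `Literature/NumberTheory/LFunctions`. Support file for the discharge of the named fact
`Literature.NumberTheory.LFunctions.polya_conjecture_first_failure` (`RHWave0.lean`): Tanaka's determination of the smallest
counterexample `906 150 257` to Pólya's conjecture `L(x) ≤ 0` (`x ≥ 2`)
[Tanaka1980, p. 187 (list of sign changes) and p. 188]. The printed proof is a machine computation
of `L(x)` for all `x ≤ 10⁹`, of which only the results are reported; this file re-does the
computation up to `x = 906150257` inside Lean, *certified*: it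
defines an executable segmented sieve together with a complete correctness proof, so that each
block of the range is discharged by one `native_decide` (files `LiouvilleSieve/Chunk*.lean`),
and the blocks are glued by `checkChunk_spec` / `checkLast_spec` below.

## The algorithm (a standard segmented sieve for `λ`; Tanaka's note does not describe his program)

Fix `P = 30103` (`30102² ≤ 906150257 < 30103²`) and the segment length `Q = 2⁵·3³·5²·7² =
1 058 400`. For a segment `[lo, lo + M)` (`Q ∣ lo`, `M ≤ Q`) an array `e : Array ℤ` is computed
with
`e[j] = ∏_{p < P prime} (-p)^{v_p(lo + j)}`  (`sieveVal`),
by multiplying, for every prime `p < P` and every `k ≥ 1` with `p^k < lo + M`, the entries at the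
multiples of `p^k` by `-p` (`mulStride`, `applyPowers`, `sieveFrom`); the powers
`2,…,32, 3,9,27, 5,25, 7,49` are applied once and for all to a *pattern* array of period `Q`
(`pattern`), which is sound because `Q ∣ lo`. Since `n = lo + j < P²`, the cofactor
`n / |e[j]|` is `1` or a single prime `≥ P`, hence
`λ(n) = sign e[j] · (if |e[j]| = n then 1 else -1)`  (`lamOf`, `lamOf_sieveVal`).
A scan (`scanC`) then accumulates `L(n)` and checks `L(n) ≤ 0`. `checkChunk s c Lin Lout` runs the
segments `s, …, s + c - 1` from `L(sQ - 1) = Lin` and returns `true` iff all checks pass and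
`L((s+c)Q - 1) = Lout`; `checkLast` treats the final partial segment `[856·Q, 906150256]`.

## Main statements

* `checkChunk_spec`  : `checkChunk s c Lin Lout = true → SegInv s Lin → SegInv (s + c) Lout`
  (for `(s + c) Q ≤ P²`), where
  `SegInv s L := Lsum (s * Q - 1) = L ∧ ∀ n, 2 ≤ n → n < s * Q → Lsum n ≤ 0` and
  `Lsum m = ∑ n ∈ Ioc 0 m, λ n`;
* `checkLast_spec`   : `checkLast Lin = true → SegInv 856 Lin →
    Lsum 906150256 = 0 ∧ ∀ n, 2 ≤ n → n < 906150257 → Lsum n ≤ 0`;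
* `liouville_906150257` : `λ(906150257) = 1` (`906150257 = 10039 · 90263`).

No axioms beyond `propext`, `Classical.choice`, `Quot.sound` are used in this file. The block
files `LiouvilleSieve/Chunk*.lean` each consist of one `native_decide`, whose auxiliary axiom
(`checkChunk_NN._native.native_decide.ax_…`, i.e. trust in the Lean compiler — the
`Lean.ofReduceBool` / `Lean.trustCompiler` family) is declared to the gate as `computational`; a
kernel evaluation (`decide`) of the ≈ `9.06·10⁸` sieve cells is out of reach by several orders of
magnitude, and no certificate for the sign of `L(n)` on a whole interval that is cheaper than
recomputing `L` is known.

## Design notes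

* This module imports only `Mathlib`/`HarnessLib`, *not* `RHWave0.lean`/`RHWave0Proofs.lean`:
  the 25 compiled blocks depend on it and must not be rebuilt when those files change. For this
  reason `Lsum` below duplicates `Literature.NumberTheory.LFunctions.PolyaCounterexample.lsum` of `RHWave0Proofs.lean`
  (same definiens, `∑ k ∈ Ioc 0 n, λ k`); the two are identified by `rfl` where the final theorem
  is assembled (`RHWave0Proofs.lean`, `Literature.NumberTheory.LFunctions.polya_conjecture_first_failure_holds`).
* `checkChunk`/`checkLast` are `@[irreducible]` so that elaborating a statement
  `checkChunk s c a b = true` never unfolds the computation; only `native_decide` evaluates it.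
* Cross-checks: the boundary values `L(36k·Q - 1)` fed to the blocks come from an independent C
  sieve (this project), which reproduces Tanaka's table of `L(k·10⁸)`, `k = 1,…,9`
  [Tanaka1980, p. 188] (`-3884, -11126, -16648, -11200, -18804, -15350, -25384, -19292, -4630`)
  and Lehman's `L(906180359) = 1`; a wrong boundary value could only make a block evaluate to
  `false`, never prove a false statement (`checkChunk_spec` has no hypothesis on them).

## References

* M. Tanaka, *A numerical investigation on cumulative sum of the Liouville function*,
  Tokyo J. Math. 3 (1980), 187–189. [Tanaka1980]
* C. B. Haselgrove, *A disproof of a conjecture of Pólya*, Mathematika 5 (1958), 141–145.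
* R. S. Lehman, *On Liouville's function*, Math. Comp. 14 (1960), 311–320 (the value
  `L(906180359) = +1` and the sieve method).
-/

open Finset ArithmeticFunction

namespace Literature.NumberTheory.LFunctions.LiouvilleSieve

/-! ## The executable sieve -/

section Computation

/-- Multiply the entries `i, i+q, i+2q, … < a.size` of `a` by `c` (in place). [folklore] -/
def mulStride (q : ℕ) (hq : 0 < q) (c : ℤ) (a : Array ℤ) (i : ℕ) : Array ℤ :=
  if h : i < a.size then
    mulStride q hq c (a.set i (a[i] * c) h) (i + q)
  else a
termination_by a.size - i
decreasing_by simp [Array.size_set]; omega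

/-- The first index `i ≥ 0` with `q ∣ lo + i` (for `0 < q`). [folklore] -/
def firstIdx (lo q : ℕ) : ℕ := (q - lo % q) % q

/-- Starting from the prime power `q = p^e`, multiply the multiples of `q, qp, qp², … < H` in the
segment `[lo, lo + a.size)` by `-p` (`fuel` bounds the number of powers). [folklore] -/
def applyPowers (lo H p : ℕ) : ℕ → ℕ → Array ℤ → Array ℤ
  | 0, _, a => a
  | fuel + 1, q, a =>
    if h : 0 < q ∧ q < H then
      applyPowers lo H p fuel (q * p) (mulStride q h.1 (-(p : ℤ)) a (firstIdx lo q))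
    else a

/-- Apply `applyPowers` for every `p ∈ ps`, starting at the power `p ^ ex p`. [folklore] -/
def sieveFrom (ps : List ℕ) (ex : ℕ → ℕ) (lo H : ℕ) (a : Array ℤ) : Array ℤ :=
  ps.foldl (fun a p => applyPowers lo H p 32 (p ^ ex p) a) a

/-- The segment length / pattern period `Q = 2⁵ · 3³ · 5² · 7² = 1 058 400`. [folklore] -/
def Q : ℕ := 1058400

/-- The sieving bound `P = 30103`: primes `p < P` are sieved; `906150257 < P²`. [folklore] -/
def P : ℕ := 30103

/-- First exponent of `p` *not* covered by the presieved pattern: the pattern takes care of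
`2^1..2^5, 3^1..3^3, 5^1..5^2, 7^1..7^2`. [folklore] -/
def startExp (p : ℕ) : ℕ :=
  if p = 2 then 6 else if p = 3 then 4 else if p = 5 then 3 else if p = 7 then 3 else 1

/-- The presieved pattern of length `M`: entry `j` is `∏_{p ≤ 7} (-p)^{min(v_p(j), startExp p - 1)}`
(for `j ≠ 0`); it serves as initial array of every segment `[lo, lo + M)` with `Q ∣ lo`. [folklore] -/
def pattern (M : ℕ) : Array ℤ :=
  sieveFrom [2, 3, 5, 7] (fun _ => 1) 0 50 (Array.replicate M 1)

/-- The primes below `P = 30103`, by trial division. [folklore] -/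
def primesList : List ℕ := (List.range P).filter Nat.Prime

/-- The sieved array of the segment `[lo, lo + init.size)`, started from the pattern `init`. [folklore] -/
def segSieve (ps : List ℕ) (lo : ℕ) (init : Array ℤ) : Array ℤ :=
  sieveFrom ps startExp lo (lo + init.size) init

/-- `λ(n)` read off the sieve value `v = ± (P-smooth part of n)`: the cofactor is `1` or a
single prime. [folklore] -/
@[inline] def lamOf (n : ℕ) (v : ℤ) : ℤ :=
  if v.natAbs = n then v.sign else -v.sign

/-- Scan the segment from index `i`: accumulate `L` and check `L ≤ 0` after every step.
Returns the final `L` and the conjunction of the checks. [folklore] -/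
def scanC (e : Array ℤ) (lo : ℕ) (i : ℕ) (L : ℤ) (ok : Bool) : ℤ × Bool :=
  if h : i < e.size then
    let L' := L + lamOf (lo + i) e[i]
    scanC e lo (i + 1) L' (ok && decide (L' ≤ 0))
  else (L, ok)
termination_by e.size - i

/-- Run segment number `s` (the range `[sQ, (s+1)Q)`) from `L(sQ - 1) = Lin`; segment `0` starts
its scan at `n = 2` with `L(1) = 1`. [folklore] -/
def segRun (ps : List ℕ) (pat : Array ℤ) (s : ℕ) (Lin : ℤ) : ℤ × Bool :=
  let e := segSieve ps (s * Q) pat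
  if s = 0 then scanC e 0 2 1 true else scanC e (s * Q) 0 Lin true

/-- Run the `cnt` consecutive segments `s, s+1, …`. [folklore] -/
def chunkRun (ps : List ℕ) (pat : Array ℤ) : ℕ → ℕ → ℤ → Bool → ℤ × Bool
  | 0, _, L, ok => (L, ok)
  | c + 1, s, L, ok =>
    let r := segRun ps pat s L
    chunkRun ps pat c (s + 1) r.1 (ok && r.2)

/-- `checkChunk s cnt Lin Lout = true` iff, starting from `L(sQ - 1) = Lin`, all the checks
`L(n) ≤ 0` (`sQ ≤ n < (s + cnt)Q`, `n ≥ 2`) pass and `L((s+cnt)Q - 1) = Lout`. [folklore] -/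
@[irreducible] def checkChunk (s cnt : ℕ) (Lin Lout : ℤ) : Bool :=
  let r := chunkRun primesList (pattern Q) cnt s Lin true
  r.2 && (r.1 == Lout)

/-- Index of the last (partial) segment: `856 · Q = 905 990 400`. [folklore] -/
def lastSeg : ℕ := 856

/-- Length of the last segment: `856 · Q + 159857 = 906 150 257`. [folklore] -/
def lastLen : ℕ := 159857

/-- `checkLast Lin = true` iff, starting from `L(856Q - 1) = Lin`, all checks `L(n) ≤ 0` for
`856Q ≤ n ≤ 906150256` pass and `L(906150256) = 0`. [folklore] -/
@[irreducible] def checkLast (Lin : ℤ) : Bool :=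
  let lo := lastSeg * Q
  let e := segSieve primesList lo ((pattern Q).extract 0 lastLen)
  let r := scanC e lo 0 Lin true
  r.2 && (r.1 == 0)

end Computation

/-! ## Specification of the array operations -/

section ArraySpecs

/-- `mulStride` preserves the size. [folklore] -/
theorem size_mulStride (q : ℕ) (hq : 0 < q) (c : ℤ) (a : Array ℤ) (i : ℕ) :
    (mulStride q hq c a i).size = a.size := by
  fun_induction mulStride q hq c a i with
  | case1 a i h ih => rw [ih, Array.size_set]
  | case2 a i h => rfl

/-- Along an arithmetic progression: shifting the start by one step. [folklore] -/
theorem stride_cond_iff {q i j : ℕ} (hji : j ≠ i) :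
    (i + q ≤ j ∧ q ∣ j - (i + q)) ↔ (i ≤ j ∧ q ∣ j - i) := by
  constructor
  · rintro ⟨h1, h2⟩
    refine ⟨by omega, ?_⟩
    have : j - i = (j - (i + q)) + q := by omega
    rw [this]
    exact (Nat.dvd_add_right h2).2 (dvd_refl q)
  · rintro ⟨h1, h2⟩
    have hlt : i < j := lt_of_le_of_ne h1 (Ne.symm hji)
    have hle : q ≤ j - i := Nat.le_of_dvd (by omega) h2
    refine ⟨by omega, ?_⟩
    have : j - (i + q) = (j - i) - q := by omega
    rw [this]
    exact Nat.dvd_sub h2 (dvd_refl q)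

/-- Entries of `mulStride`: the entries `j ≥ i` with `q ∣ j - i` are multiplied by `c`. [folklore] -/
theorem getElem?_mulStride (q : ℕ) (hq : 0 < q) (c : ℤ) (a : Array ℤ) (i j : ℕ) :
    (mulStride q hq c a i)[j]? =
      (a[j]?).map (fun x => if i ≤ j ∧ q ∣ j - i then x * c else x) := by
  fun_induction mulStride q hq c a i with
  | case1 a i h ih =>
    rw [ih, Array.getElem?_set]
    by_cases hij : i = j
    · subst hij
      simp [Array.getElem?_eq_getElem h]
      omega
    · rw [if_neg hij]
      have key := stride_cond_iff (q := q) (Ne.symm hij)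
      simp only [key]
  | case2 a i h =>
    rcases Nat.lt_or_ge j a.size with hj | hj
    · have hc : ¬ (i ≤ j ∧ q ∣ j - i) := fun h' => h (by omega)
      simp [Array.getElem?_eq_getElem hj, hc]
    · simp [Array.getElem?_eq_none hj]

/-- If `q ∣ lo + i₀` with `i₀ < q`, then `q ∣ lo + j` iff `j` lies on the progression
`i₀, i₀ + q, …`. [folklore] -/
theorem dvd_add_iff_of_first {q lo i₀ : ℕ} (hi : i₀ < q) (h0 : q ∣ lo + i₀)
    (j : ℕ) : q ∣ lo + j ↔ (i₀ ≤ j ∧ q ∣ j - i₀) := by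
  constructor
  · intro hj
    have hle : i₀ ≤ j := by
      by_contra hlt
      have hlt : j < i₀ := Nat.lt_of_not_le hlt
      have hd : q ∣ (lo + i₀) - (lo + j) := Nat.dvd_sub h0 hj
      have hpos : 0 < (lo + i₀) - (lo + j) := by omega
      have := Nat.le_of_dvd hpos hd
      omega
    refine ⟨hle, ?_⟩
    have : j - i₀ = (lo + j) - (lo + i₀) := by omega
    rw [this]
    exact Nat.dvd_sub hj h0
  · rintro ⟨hle, hd⟩
    have : lo + j = (lo + i₀) + (j - i₀) := by omega
    rw [this]
    exact (Nat.dvd_add_right h0).2 hd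

/-- `firstIdx lo q < q`. [folklore] -/
theorem firstIdx_lt (lo q : ℕ) (hq : 0 < q) : firstIdx lo q < q := Nat.mod_lt _ hq

/-- `q ∣ lo + firstIdx lo q`. [folklore] -/
theorem dvd_add_firstIdx (lo q : ℕ) (hq : 0 < q) : q ∣ lo + firstIdx lo q := by
  unfold firstIdx
  have hr : lo % q < q := Nat.mod_lt _ hq
  rcases Nat.eq_zero_or_pos (lo % q) with h0 | hpos
  · rw [h0, Nat.sub_zero, Nat.mod_self, Nat.add_zero]
    exact Nat.dvd_of_mod_eq_zero h0
  · rw [Nat.mod_eq_of_lt (by omega : q - lo % q < q)]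
    have : lo + (q - lo % q) = q * (lo / q) + q := by
      have := Nat.mod_add_div lo q
      omega
    rw [this]
    exact (Nat.dvd_add_right (Nat.dvd_mul_right q _)).2 (dvd_refl q)

/-- The multiplier contributed by the powers `p^e, …, p^{E-1}` at `n`. [folklore] -/
def rawProd (p n e E : ℕ) : ℤ := ∏ k ∈ Finset.Ico e E, if p ^ k ∣ n then -(p : ℤ) else 1

/-- The exponent at which `applyPowers … fuel (p^e)` stops. [folklore] -/
def stopExp (p H : ℕ) : ℕ → ℕ → ℕ
  | 0, e => e
  | fuel + 1, e => if 0 < p ^ e ∧ p ^ e < H then stopExp p H fuel (e + 1) else e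

/-- `stopExp` does not decrease the exponent. [folklore] -/
theorem le_stopExp (p H fuel e : ℕ) : e ≤ stopExp p H fuel e := by
  induction fuel generalizing e with
  | zero => exact le_rfl
  | succ f ih =>
    simp only [stopExp]
    split_ifs
    · exact (Nat.le_succ e).trans (ih (e + 1))
    · exact le_rfl

/-- With enough fuel, `applyPowers` stops at an exponent `E` with `H ≤ p ^ E`. [folklore] -/
theorem le_pow_stopExp (p H fuel e : ℕ) (hp : 0 < p) (h : H ≤ p ^ (e + fuel)) :
    H ≤ p ^ stopExp p H fuel e := by
  induction fuel generalizing e with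
  | zero => simpa [stopExp] using h
  | succ f ih =>
    simp only [stopExp]
    split_ifs with hc
    · exact ih (e + 1) (by rw [Nat.add_right_comm]; exact h)
    · exact Nat.le_of_not_lt (fun hc' => hc ⟨Nat.pow_pos hp, hc'⟩)

/-- Empty range. [folklore] -/
theorem rawProd_self (p n e : ℕ) : rawProd p n e e = 1 := by
  simp [rawProd]

/-- Peeling off the bottom factor of `rawProd`. [folklore] -/
theorem rawProd_succ (p n e E : ℕ) (h : e < E) :
    rawProd p n e E = (if p ^ e ∣ n then -(p : ℤ) else 1) * rawProd p n (e + 1) E := by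
  unfold rawProd
  exact Finset.prod_eq_prod_Ico_succ_bot h _

/-- `applyPowers` preserves the size. [folklore] -/
theorem size_applyPowers (lo H p fuel q : ℕ) (a : Array ℤ) :
    (applyPowers lo H p fuel q a).size = a.size := by
  induction fuel generalizing q a with
  | zero => rfl
  | succ f ih =>
    simp only [applyPowers]
    split_ifs with h
    · rw [ih, size_mulStride]
    · rfl

/-- Entries of `applyPowers`. [folklore] -/
theorem getElem?_applyPowers (lo H p fuel e : ℕ) (a : Array ℤ) (j : ℕ) :
    (applyPowers lo H p fuel (p ^ e) a)[j]? =
      (a[j]?).map (· * rawProd p (lo + j) e (stopExp p H fuel e)) := by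
  induction fuel generalizing e a with
  | zero => simp [applyPowers, stopExp, rawProd_self]
  | succ f ih =>
    simp only [applyPowers, stopExp]
    by_cases h : 0 < p ^ e ∧ p ^ e < H
    · rw [dif_pos h, if_pos h, ← pow_succ, ih (e + 1), getElem?_mulStride, Option.map_map,
        rawProd_succ p (lo + j) e _ (Nat.lt_of_lt_of_le (Nat.lt_succ_self e) (le_stopExp _ _ _ _))]
      have hfi := dvd_add_iff_of_first (firstIdx_lt lo (p ^ e) h.1)
        (dvd_add_firstIdx lo (p ^ e) h.1) j
      congr 1
      funext x
      simp only [Function.comp]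
      by_cases hd : p ^ e ∣ lo + j
      · rw [if_pos (hfi.1 hd), if_pos hd]; ring
      · rw [if_neg (fun h' => hd (hfi.2 h')), if_neg hd]; ring
    · rw [dif_neg h, if_neg h, rawProd_self]
      simp

/-- `sieveFrom` preserves the size. [folklore] -/
theorem size_sieveFrom (ps : List ℕ) (ex : ℕ → ℕ) (lo H : ℕ) (a : Array ℤ) :
    (sieveFrom ps ex lo H a).size = a.size := by
  induction ps generalizing a with
  | nil => rfl
  | cons p ps ih =>
    simp only [sieveFrom, List.foldl_cons] at ih ⊢
    rw [ih, size_applyPowers]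

/-- Entries of `sieveFrom`. [folklore] -/
theorem getElem?_sieveFrom (ps : List ℕ) (ex : ℕ → ℕ) (lo H : ℕ) (a : Array ℤ) (j : ℕ) :
    (sieveFrom ps ex lo H a)[j]? =
      (a[j]?).map
        (· * (ps.map fun p => rawProd p (lo + j) (ex p) (stopExp p H 32 (ex p))).prod) := by
  induction ps generalizing a with
  | nil => simp [sieveFrom]
  | cons p ps ih =>
    simp only [sieveFrom, List.foldl_cons] at ih ⊢
    rw [ih, getElem?_applyPowers, Option.map_map]
    congr 1
    funext x
    simp [mul_assoc]

end ArraySpecs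

/-! ## Arithmetic of the sieve values -/

section Arithmetic

/-- The set of sieving primes `p < P`. [folklore] -/
def PF : Finset ℕ := (Finset.range P).filter Nat.Prime

/-- Membership in `PF`. [folklore] -/
theorem mem_PF {p : ℕ} : p ∈ PF ↔ p < P ∧ p.Prime := by simp [PF]

/-- `primesList` enumerates `PF`. [folklore] -/
theorem primesList_toFinset : primesList.toFinset = PF := by
  ext p
  simp [primesList, PF]

/-- `primesList` has no duplicates. [folklore] -/
theorem nodup_primesList : primesList.Nodup := List.nodup_range.filter _

/-- A product over `primesList` is a product over `PF`. [folklore] -/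
theorem prod_primesList (f : ℕ → ℤ) : (primesList.map f).prod = ∏ p ∈ PF, f p := by
  rw [← primesList_toFinset, List.prod_toFinset f nodup_primesList]

/-- The sieve value of `n`: `∏_{p < P prime} (-p)^{v_p(n)}`. [folklore] -/
def sieveVal (n : ℕ) : ℤ := ∏ p ∈ PF, (-(p : ℤ)) ^ n.factorization p

/-- The `P`-smooth part of `n`. [folklore] -/
def smoothPart (n : ℕ) : ℕ := ∏ p ∈ PF, p ^ n.factorization p

/-- The number of prime factors `p < P` of `n`, with multiplicity. [folklore] -/
def smallOmega (n : ℕ) : ℕ := ∑ p ∈ PF, n.factorization p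

/-- For `p` prime and `0 < n < p ^ E`, the multipliers of `p, p², …, p^{E-1}` at `n` combine to
`(-p)^{v_p(n)}`. [folklore] -/
theorem rawProd_one_eq {p n E : ℕ} (hp : p.Prime) (hn : n ≠ 0) (hE : n < p ^ E) :
    rawProd p n 1 E = (-(p : ℤ)) ^ n.factorization p := by
  set v := n.factorization p with hv
  have hdv : ∀ k, k ≤ v → p ^ k ∣ n := fun k hk =>
    (pow_dvd_pow p hk).trans (Nat.ordProj_dvd n p)
  have hvE : v < E := by
    by_contra hle
    have h1 : p ^ E ∣ n := hdv E (Nat.le_of_not_lt hle)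
    exact absurd (Nat.le_of_dvd (Nat.pos_of_ne_zero hn) h1) (not_le.mpr hE)
  unfold rawProd
  rw [← Finset.prod_Ico_consecutive _ (show 1 ≤ v + 1 by omega) (show v + 1 ≤ E by omega)]
  have h1 : ∏ k ∈ Finset.Ico 1 (v + 1), (if p ^ k ∣ n then -(p : ℤ) else 1) = (-(p : ℤ)) ^ v := by
    rw [Finset.prod_congr rfl (fun k hk => if_pos (hdv k (Nat.lt_succ_iff.mp
      (Finset.mem_Ico.mp hk).2))), Finset.prod_const, Nat.card_Ico, Nat.succ_sub_one]
  have h2 : ∏ k ∈ Finset.Ico (v + 1) E, (if p ^ k ∣ n then -(p : ℤ) else 1) = 1 := by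
    refine Finset.prod_eq_one (fun k hk => ?_)
    rw [if_neg]
    rw [hp.pow_dvd_iff_le_factorization hn]
    have := (Finset.mem_Ico.mp hk).1
    omega
  rw [h1, h2, mul_one]

/-- Periodicity of `rawProd` in `n` modulo any common multiple of the powers involved. [folklore] -/
theorem rawProd_add_of_dvd {p lo j e s : ℕ} (h : ∀ k < s, p ^ k ∣ lo) :
    rawProd p (lo + j) e s = rawProd p j e s := by
  unfold rawProd
  refine Finset.prod_congr rfl (fun k hk => ?_)
  simp only [Nat.dvd_add_right (h k (Finset.mem_Ico.mp hk).2)]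

/-- Splitting the range of `rawProd`. [folklore] -/
theorem rawProd_mul {p n a b c : ℕ} (hab : a ≤ b) (hbc : b ≤ c) :
    rawProd p n a b * rawProd p n b c = rawProd p n a c :=
  Finset.prod_Ico_consecutive _ hab hbc

/-- The pattern has the requested size. [folklore] -/
theorem size_pattern (M : ℕ) : (pattern M).size = M := by
  simp [pattern, size_sieveFrom]

/-- Entries of the presieved pattern. [folklore] -/
theorem getElem?_pattern (M j : ℕ) (hj : j < M) :
    (pattern M)[j]? = some (rawProd 2 j 1 6 * rawProd 3 j 1 4 * rawProd 5 j 1 3 * rawProd 7 j 1 3) := by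
  have e2 : stopExp 2 50 32 1 = 6 := by decide
  have e3 : stopExp 3 50 32 1 = 4 := by decide
  have e5 : stopExp 5 50 32 1 = 3 := by decide
  have e7 : stopExp 7 50 32 1 = 3 := by decide
  rw [pattern, getElem?_sieveFrom, Array.getElem?_replicate, if_pos hj]
  simp [e2, e3, e5, e7, mul_assoc]

/-- `1 ≤ startExp p`. [folklore] -/
theorem one_le_startExp (p : ℕ) : 1 ≤ startExp p := by
  unfold startExp; split_ifs <;> omega

/-- `startExp p = 1` for `p ∉ {2, 3, 5, 7}`. [folklore] -/
theorem startExp_of_ne {p : ℕ} (h2 : p ≠ 2) (h3 : p ≠ 3) (h5 : p ≠ 5) (h7 : p ≠ 7) :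
    startExp p = 1 := by
  simp [startExp, h2, h3, h5, h7]

/-- `P² < 2³²` (so `32` extra powers of any prime exceed every segment bound). [folklore] -/
theorem P_sq_lt : P ^ 2 < 2 ^ 32 := by decide

/-- The entries of a sieved segment are the sieve values. [folklore] -/
theorem getElem?_segSieve (lo : ℕ) (init : Array ℤ) (hlo : Q ∣ lo) (hH : lo + init.size ≤ P ^ 2)
    (hinit : ∀ j < init.size, init[j]? = (pattern Q)[j]?) (j : ℕ) (hj : j < init.size)
    (hn : lo + j ≠ 0) :
    (segSieve primesList lo init)[j]? = some (sieveVal (lo + j)) := by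
  have hjQ : j < Q := by
    by_contra hge
    have h1 := hinit j hj
    rw [Array.getElem?_eq_getElem hj, Eq.comm, Array.getElem?_eq_none
      (by rw [size_pattern]; exact Nat.le_of_not_lt hge)] at h1
    exact Option.some_ne_none _ h1.symm
  rw [segSieve, getElem?_sieveFrom, hinit j hj, getElem?_pattern Q j hjQ, Option.map_some,
    prod_primesList]
  have hnH : lo + j < lo + init.size := by omega
  -- Step 1: the pattern factors, moved from `j` to `n = lo + j` and spread over `PF`.
  have hdvd : ∀ (p s : ℕ), p ^ (s - 1) ∣ Q → ∀ k < s, p ^ k ∣ lo := fun p s hs k hk =>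
    ((pow_dvd_pow p (by omega : k ≤ s - 1)).trans hs).trans hlo
  have hpat : rawProd 2 j 1 6 * rawProd 3 j 1 4 * rawProd 5 j 1 3 * rawProd 7 j 1 3 =
      ∏ p ∈ PF, rawProd p (lo + j) 1 (startExp p) := by
    rw [← rawProd_add_of_dvd (lo := lo) (hdvd 2 6 (by decide)),
      ← rawProd_add_of_dvd (lo := lo) (hdvd 3 4 (by decide)),
      ← rawProd_add_of_dvd (lo := lo) (hdvd 5 3 (by decide)),
      ← rawProd_add_of_dvd (lo := lo) (hdvd 7 3 (by decide))]
    have hsub : ({2, 3, 5, 7} : Finset ℕ) ⊆ PF := by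
      intro p hp
      simp only [Finset.mem_insert, Finset.mem_singleton] at hp
      rw [mem_PF, P]
      rcases hp with rfl | rfl | rfl | rfl <;> norm_num
    rw [← Finset.prod_subset hsub]
    · simp [startExp, mul_assoc]
    · intro p _ hp
      simp only [Finset.mem_insert, Finset.mem_singleton, not_or] at hp
      rw [startExp_of_ne hp.1 hp.2.1 hp.2.2.1 hp.2.2.2, rawProd_self]
  rw [hpat, ← Finset.prod_mul_distrib, sieveVal]
  refine congrArg some (Finset.prod_congr rfl (fun p hp => ?_))
  have hp' := (mem_PF.mp hp).2
  have hle : startExp p ≤ stopExp p (lo + init.size) 32 (startExp p) := le_stopExp _ _ _ _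
  rw [rawProd_mul (one_le_startExp p) hle]
  refine rawProd_one_eq hp' hn (lt_of_lt_of_le hnH (le_pow_stopExp p _ 32 _ hp'.pos ?_))
  calc lo + init.size ≤ P ^ 2 := hH
    _ ≤ 2 ^ 32 := P_sq_lt.le
    _ ≤ 2 ^ (startExp p + 32) := Nat.pow_le_pow_right (by norm_num) (by omega)
    _ ≤ p ^ (startExp p + 32) := Nat.pow_le_pow_left hp'.two_le _

/-- `sieveVal n = (-1)^{smallOmega n} · smoothPart n`. [folklore] -/
theorem sieveVal_eq (n : ℕ) : sieveVal n = (-1) ^ smallOmega n * (smoothPart n : ℤ) := by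
  unfold sieveVal smallOmega smoothPart
  rw [Nat.cast_prod, ← Finset.prod_pow_eq_pow_sum, ← Finset.prod_mul_distrib]
  refine Finset.prod_congr rfl (fun p _ => ?_)
  rw [Nat.cast_pow, ← mul_pow, neg_one_mul]

/-- The smooth part is positive. [folklore] -/
theorem smoothPart_pos (n : ℕ) : 0 < smoothPart n :=
  Finset.prod_pos (fun _ hp => pow_pos (mem_PF.mp hp).2.pos _)

/-- The key arithmetic fact: for `0 < n < P²`, `λ(n) = (-1)^{smallOmega n} · [smoothPart n = n]±`.
[folklore] -/
theorem liouville_eq_of_lt (n : ℕ) (hn : n ≠ 0) (hnP : n < P ^ 2) :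
    (liouville n : ℤ) = (-1) ^ smallOmega n * (if smoothPart n = n then 1 else -1) := by
  classical
  -- the prime factorisation of `n`, split at `P`
  set small := n.primeFactors.filter (· < P) with hsmall
  set big := n.primeFactors.filter (fun p => ¬ p < P) with hbig
  set B := ∏ p ∈ big, p ^ n.factorization p with hB
  set u := ∑ p ∈ big, n.factorization p with hu
  have hprod : ∏ p ∈ n.primeFactors, p ^ n.factorization p = n := by
    have := Nat.prod_factorization_pow_eq_self hn
    rwa [Finsupp.prod, Nat.support_factorization] at this
  have hsmallPF : small ⊆ PF := fun p hp => by
    rw [hsmall, Finset.mem_filter] at hp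
    exact mem_PF.mpr ⟨hp.2, Nat.prime_of_mem_primeFactors hp.1⟩
  have hzero : ∀ p ∈ PF, p ∉ small → n.factorization p = 0 := fun p hp hps => by
    have : p ∉ n.primeFactors := fun h => hps (by
      rw [hsmall, Finset.mem_filter]; exact ⟨h, (mem_PF.mp hp).1⟩)
    exact Finsupp.notMem_support_iff.mp (by rwa [Nat.support_factorization])
  have hA : smoothPart n = ∏ p ∈ small, p ^ n.factorization p := by
    rw [smoothPart, ← Finset.prod_subset hsmallPF (fun p hp hps => by rw [hzero p hp hps, pow_zero])]
  have ht : smallOmega n = ∑ p ∈ small, n.factorization p := by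
    rw [smallOmega, ← Finset.sum_subset hsmallPF (fun p hp hps => hzero p hp hps)]
  have hAB : smoothPart n * B = n := by
    rw [hA, hB, hsmall, hbig, Finset.prod_filter_mul_prod_filter_not, hprod]
  have hOmega : cardFactors n = smallOmega n + u := by
    rw [ArithmeticFunction.cardFactors_eq_sum_factorization, Finsupp.sum, Nat.support_factorization,
      ht, hu, hsmall, hbig, Finset.sum_filter_add_sum_filter_not]
  -- `B ≥ P ^ u` and `B ≤ n < P²`, hence `u ≤ 1`
  have hBge : P ^ u ≤ B := by
    rw [hu, hB, ← Finset.prod_pow_eq_pow_sum]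
    refine Finset.prod_le_prod (fun p _ => Nat.zero_le _) (fun p hp => ?_)
    rw [hbig, Finset.mem_filter] at hp
    exact Nat.pow_le_pow_left (Nat.le_of_not_lt hp.2) _
  have hBle : B ≤ n := by
    have := smoothPart_pos n
    nlinarith [hAB]
  have hu1 : u < 2 := by
    have : P ^ u < P ^ 2 := lt_of_le_of_lt (hBge.trans hBle) hnP
    exact (Nat.pow_lt_pow_iff_right (by decide : 1 < P)).mp this
  rw [ArithmeticFunction.liouville_apply hn, hOmega, pow_add]
  suffices hu2 : ((-1 : ℤ) ^ u) = (if smoothPart n = n then 1 else -1) by rw [hu2]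
  interval_cases hu' : u
  · -- `u = 0`: no prime factor `≥ P`, `B = 1`, `smoothPart n = n`
    have hbig0 : ∀ p ∈ big, n.factorization p = 0 :=
      (Finset.sum_eq_zero_iff_of_nonneg (fun _ _ => Nat.zero_le _)).mp hu'
    have hB1 : B = 1 := by
      rw [hB]
      exact Finset.prod_eq_one (fun p hp => by rw [hbig0 p hp, pow_zero])
    rw [hB1, mul_one] at hAB
    rw [if_pos hAB, pow_zero]
  · -- `u = 1`: one prime factor `≥ P`, `smoothPart n < n`
    have hAne : smoothPart n ≠ n := by
      intro hAn
      rw [hAn] at hAB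
      have hB1 : B = 1 :=
        Nat.eq_of_mul_eq_mul_left (Nat.pos_of_ne_zero hn) (by rw [mul_one]; exact hAB)
      have : P ≤ 1 := by simpa [hB1] using hBge
      exact absurd this (by decide)
    rw [if_neg hAne, pow_one]

/-- Reading `λ(n)` off the sieve value. [folklore] -/
theorem lamOf_sieveVal (n : ℕ) (hn : n ≠ 0) (hnP : n < P ^ 2) :
    lamOf n (sieveVal n) = liouville n := by
  rw [liouville_eq_of_lt n hn hnP, sieveVal_eq]
  unfold lamOf
  have hA := smoothPart_pos n
  have habs : ((-1 : ℤ) ^ smallOmega n * (smoothPart n : ℤ)).natAbs = smoothPart n := by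
    rw [Int.natAbs_mul, Int.natAbs_pow, Int.natAbs_neg, Int.natAbs_one, one_pow, one_mul,
      Int.natAbs_natCast]
  have hsign : ((-1 : ℤ) ^ smallOmega n * (smoothPart n : ℤ)).sign = (-1) ^ smallOmega n := by
    rw [Int.sign_mul, Int.sign_natCast_of_ne_zero hA.ne', mul_one]
    rcases neg_one_pow_eq_or ℤ (smallOmega n) with h | h
    · rw [h]; rfl
    · rw [h]; rfl
  rw [habs, hsign]
  by_cases hAn : smoothPart n = n
  · rw [if_pos hAn, if_pos hAn, mul_one]
  · rw [if_neg hAn, if_neg hAn, mul_neg_one]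

end Arithmetic

/-! ## The scan and the chunk invariant -/

section Scan

/-- `Lsum m = L(m) = ∑_{1 ≤ n ≤ m} λ(n)` (with `ℕ` argument; equals `liouvilleSum m`, and is
definitionally `Literature.RH.PolyaCounterexample.lsum m` of `RHWave0Proofs.lean`, which this module
deliberately does not import — see the design notes). [folklore] -/
def Lsum (m : ℕ) : ℤ := ∑ n ∈ Finset.Ioc 0 m, (liouville n : ℤ)

/-- `L(0) = 0`. [folklore] -/
theorem Lsum_zero : Lsum 0 = 0 := by simp [Lsum]

/-- `L(m + 1) = L(m) + λ(m + 1)`. [folklore] -/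
theorem Lsum_succ (m : ℕ) : Lsum (m + 1) = Lsum m + liouville (m + 1) := by
  unfold Lsum
  rw [Finset.sum_Ioc_succ_top (Nat.zero_le m)]

/-- `L(1) = 1`. [folklore] -/
theorem Lsum_one : Lsum 1 = 1 := by
  rw [show (1 : ℕ) = 0 + 1 from rfl, Lsum_succ, Lsum_zero, zero_add, zero_add,
    ArithmeticFunction.liouville_apply_one]

/-- Specification of the scan: final value and meaning of the flag. [folklore] -/
theorem scanC_spec (e : Array ℤ) (lo i : ℕ) (L : ℤ) (ok : Bool) (hi : i ≤ e.size)
    (h1 : 1 ≤ lo + i)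
    (hcorr : ∀ j, i ≤ j → (hj : j < e.size) → lamOf (lo + j) e[j] = liouville (lo + j))
    (hL : L = Lsum (lo + i - 1)) :
    (scanC e lo i L ok).1 = Lsum (lo + e.size - 1) ∧
      ((scanC e lo i L ok).2 = true → ok = true ∧ ∀ j, i ≤ j → j < e.size → Lsum (lo + j) ≤ 0) := by
  induction hd : e.size - i using Nat.strong_induction_on generalizing i L ok with
  | _ d ih =>
    rw [scanC]
    by_cases h : i < e.size
    · rw [dif_pos h]
      simp only
      have hL' : L + lamOf (lo + i) e[i] = Lsum (lo + (i + 1) - 1) := by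
        rw [hcorr i le_rfl h, hL]
        have : lo + (i + 1) - 1 = (lo + i - 1) + 1 := by omega
        rw [this, Lsum_succ, Nat.sub_add_cancel h1]
      have hrec := ih (e.size - (i + 1)) (by omega) (i + 1) (L + lamOf (lo + i) e[i])
        (ok && decide (L + lamOf (lo + i) e[i] ≤ 0)) (by omega) (by omega)
        (fun j hj hj' => hcorr j (by omega) hj') hL' rfl
      refine ⟨hrec.1, fun hok => ?_⟩
      obtain ⟨hok', hall⟩ := hrec.2 hok
      rw [Bool.and_eq_true, decide_eq_true_eq] at hok'
      refine ⟨hok'.1, fun j hij hj => ?_⟩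
      rcases Nat.eq_or_lt_of_le hij with hji | hji
      · subst hji
        have : lo + i = lo + (i + 1) - 1 := by omega
        rw [this, ← hL']
        exact hok'.2
      · exact hall j hji hj
    · rw [dif_neg h]
      have hie : i = e.size := le_antisymm hi (Nat.le_of_not_lt h)
      subst hie
      refine ⟨hL, fun hok => ⟨hok, fun j hij hj => absurd hj (Nat.not_lt_of_le hij)⟩⟩

/-- The invariant handed over from chunk to chunk: `L(sQ - 1) = L` and `L(n) ≤ 0` for
`2 ≤ n < sQ`. [folklore] -/
def SegInv (s : ℕ) (L : ℤ) : Prop :=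
  Lsum (s * Q - 1) = L ∧ ∀ n, 2 ≤ n → n < s * Q → Lsum n ≤ 0

/-- The (vacuous) invariant before segment `0`. [folklore] -/
theorem segInv_zero : SegInv 0 0 :=
  ⟨by simp [Lsum_zero], fun n _ hn => absurd hn (Nat.not_lt_zero n)⟩

/-- `segSieve` preserves the size. [folklore] -/
theorem size_segSieve (ps : List ℕ) (lo : ℕ) (init : Array ℤ) :
    (segSieve ps lo init).size = init.size :=
  size_sieveFrom _ _ _ _ _

/-- Correctness of the entries of a sieved segment, in `getElem` form. [folklore] -/
theorem lamOf_segSieve (lo : ℕ) (init : Array ℤ) (hlo : Q ∣ lo) (hH : lo + init.size ≤ P ^ 2)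
    (hinit : ∀ j < init.size, init[j]? = (pattern Q)[j]?) (j : ℕ)
    (hj : j < (segSieve primesList lo init).size) (hn : lo + j ≠ 0) :
    lamOf (lo + j) (segSieve primesList lo init)[j] = liouville (lo + j) := by
  have hj' : j < init.size := by rwa [size_segSieve] at hj
  have h := getElem?_segSieve lo init hlo hH hinit j hj' hn
  rw [Array.getElem?_eq_getElem hj, Option.some.injEq] at h
  rw [h]
  exact lamOf_sieveVal _ hn (by omega)

/-- One segment preserves the invariant. [folklore] -/
theorem segRun_spec (s : ℕ) (Lin : ℤ) (hs : (s + 1) * Q ≤ P ^ 2) (hinv : SegInv s Lin)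
    (hok : (segRun primesList (pattern Q) s Lin).2 = true) :
    SegInv (s + 1) (segRun primesList (pattern Q) s Lin).1 := by
  have hsize : (segSieve primesList (s * Q) (pattern Q)).size = Q := by
    rw [size_segSieve, size_pattern]
  have hlo : Q ∣ s * Q := Dvd.intro_left s rfl
  have hH : s * Q + (pattern Q).size ≤ P ^ 2 := by rw [size_pattern]; linarith
  have hcorr := lamOf_segSieve (s * Q) (pattern Q) hlo hH (fun j _ => rfl)
  unfold segRun at hok ⊢
  simp only at hok ⊢
  by_cases hs0 : s = 0
  · subst hs0
    rw [if_pos rfl] at hok ⊢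
    have hspec := scanC_spec (segSieve primesList (0 * Q) (pattern Q)) 0 2 1 true
      (by rw [hsize]; decide) (by omega)
      (fun j hj hj' => hcorr j hj' (by omega)) (by rw [Lsum_one])
    refine ⟨?_, fun n h2 hn => ?_⟩
    · rw [hspec.1, hsize]; simp
    · have hall := (hspec.2 hok).2 n h2 (by rw [hsize]; simpa using hn)
      simpa using hall
  · rw [if_neg hs0] at hok ⊢
    have hs1 : 1 ≤ s * Q := Nat.one_le_iff_ne_zero.mpr (Nat.mul_ne_zero hs0 (by decide))
    have hspec := scanC_spec (segSieve primesList (s * Q) (pattern Q)) (s * Q) 0 Lin true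
      (Nat.zero_le _) (by omega)
      (fun j _ hj' => hcorr j hj' (by omega)) (by rw [Nat.add_zero, hinv.1])
    refine ⟨?_, fun n h2 hn => ?_⟩
    · rw [hspec.1, hsize, add_mul, one_mul]
    · rcases Nat.lt_or_ge n (s * Q) with hlt | hge
      · exact hinv.2 n h2 hlt
      · have hall := (hspec.2 hok).2 (n - s * Q) (Nat.zero_le _)
          (by rw [hsize]; rw [add_mul, one_mul] at hn; omega)
        rwa [Nat.add_sub_cancel' hge] at hall

/-- A chunk of consecutive segments preserves the invariant. [folklore] -/
theorem chunkRun_spec (c s : ℕ) (L : ℤ) (ok : Bool) (hs : (s + c) * Q ≤ P ^ 2)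
    (hok : (chunkRun primesList (pattern Q) c s L ok).2 = true) :
    ok = true ∧ (SegInv s L → SegInv (s + c) (chunkRun primesList (pattern Q) c s L ok).1) := by
  induction c generalizing s L ok with
  | zero =>
    simp only [chunkRun] at hok ⊢
    exact ⟨hok, fun h => by simpa using h⟩
  | succ c ih =>
    simp only [chunkRun] at hok ⊢
    have hs' : (s + 1 + c) * Q ≤ P ^ 2 := by rwa [add_assoc, add_comm 1 c]
    obtain ⟨hok1, hinv⟩ := ih (s + 1) _ _ hs' hok
    rw [Bool.and_eq_true] at hok1
    refine ⟨hok1.1, fun h0 => ?_⟩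
    have h1 := segRun_spec s L (le_trans (Nat.mul_le_mul_right Q (by omega)) hs) h0 hok1.2
    have := hinv h1
    rwa [add_assoc, add_comm 1 c] at this

/-- **Chunk certificate.** If `checkChunk s c Lin Lout` evaluates to `true` (by `native_decide`
in the chunk files) then the invariant is carried from `s` to `s + c`. [folklore] -/
theorem checkChunk_spec (s c : ℕ) (Lin Lout : ℤ) (hs : (s + c) * Q ≤ P ^ 2)
    (h : checkChunk s c Lin Lout = true) (hinv : SegInv s Lin) : SegInv (s + c) Lout := by
  unfold checkChunk at h
  simp only [Bool.and_eq_true, beq_iff_eq] at h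
  have := (chunkRun_spec c s Lin true hs h.1).2 hinv
  rwa [h.2] at this

/-- `856 · Q + 159857 = 906150257`. [folklore] -/
theorem lastSeg_mul_Q_add : lastSeg * Q + lastLen = 906150257 := by decide

/-- **Last segment certificate.** [folklore] -/
theorem checkLast_spec (Lin : ℤ) (h : checkLast Lin = true) (hinv : SegInv lastSeg Lin) :
    Lsum 906150256 = 0 ∧ ∀ n, 2 ≤ n → n < 906150257 → Lsum n ≤ 0 := by
  unfold checkLast at h
  simp only [Bool.and_eq_true, beq_iff_eq] at h
  set init := (pattern Q).extract 0 lastLen with hinit_def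
  have hinit_size : init.size = lastLen := by
    rw [hinit_def, Array.size_extract, size_pattern]; decide
  have hinit : ∀ j < init.size, init[j]? = (pattern Q)[j]? := by
    intro j hj
    have hmin : min lastLen Q - 0 = lastLen := by decide
    rw [hinit_def, Array.getElem?_extract, size_pattern, zero_add, if_pos (by rw [hmin]; omega)]
  have hlo : Q ∣ lastSeg * Q := Dvd.intro_left _ rfl
  have hH : lastSeg * Q + init.size ≤ P ^ 2 := by rw [hinit_size]; decide
  have hcorr := lamOf_segSieve (lastSeg * Q) init hlo hH hinit
  have hpos : 0 < lastSeg * Q := by decide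
  have hspec := scanC_spec (segSieve primesList (lastSeg * Q) init) (lastSeg * Q) 0 Lin true
    (Nat.zero_le _) (by decide) (fun j _ hj' => hcorr j hj' (by omega))
    (by rw [Nat.add_zero, hinv.1])
  rw [size_segSieve, hinit_size, lastSeg_mul_Q_add] at hspec
  refine ⟨by rw [← h.2, hspec.1], fun n h2 hn => ?_⟩
  rcases Nat.lt_or_ge n (lastSeg * Q) with hlt | hge
  · exact hinv.2 n h2 hlt
  · have hall := (hspec.2 h.1).2 (n - lastSeg * Q) (Nat.zero_le _)
      (by have := lastSeg_mul_Q_add; omega)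
    rwa [Nat.add_sub_cancel' hge] at hall

/-- `λ(906150257) = 1`, as `906150257 = 10039 · 90263` with both factors prime. [folklore] -/
theorem liouville_906150257 : (liouville 906150257 : ℤ) = 1 := by
  have h1 : Nat.Prime 10039 := by norm_num
  have h2 : Nat.Prime 90263 := by norm_num
  rw [show (906150257 : ℕ) = 10039 * 90263 by norm_num, ArithmeticFunction.liouville_apply_mul,
    ArithmeticFunction.liouville_apply h1.ne_zero, ArithmeticFunction.liouville_apply h2.ne_zero,
    ArithmeticFunction.cardFactors_apply_prime h1, ArithmeticFunction.cardFactors_apply_prime h2]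
  norm_num

/-- Final assembly step: from the invariant at the last segment and the last certificate,
`L(906150257) = 1` and `L(n) ≤ 0` for `2 ≤ n < 906150257`. [folklore] -/
theorem final_of_segInv (Lin : ℤ) (h : checkLast Lin = true) (hinv : SegInv lastSeg Lin) :
    Lsum 906150257 = 1 ∧ ∀ n, 2 ≤ n → n < 906150257 → Lsum n ≤ 0 := by
  obtain ⟨h0, hall⟩ := checkLast_spec Lin h hinv
  refine ⟨?_, hall⟩
  rw [show (906150257 : ℕ) = 906150256 + 1 from rfl, Lsum_succ, h0, zero_add]
  exact liouville_906150257

end Scan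



end Literature.NumberTheory.LFunctions.LiouvilleSieve
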